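import Mathlib
import Literature.Combinatorics.Optimization.PatternMatrixRankUpperBounds
import Literature.Combinatorics.Optimization.KMRLpLowerBoundsUnconditional
import HarnessLib

/-!
# Kothari–Meka–Raghavendra 2017, Theorem 1.11: a weakly-exponential separation between approximate
# non-negative rank (and rank) and non-negative rank — PROVED

Source: P. K. Kothari, R. Meka, P. Raghavendra, *Approximating rectangles by juntas and weakly-exponential
lower bounds for LP relaxations of CSPs*, STOC 2017 / SIAM J. Comput. 51 (2022) = arXiv:1610.02704
[KothariMekaRaghavendra2017]; held text `paper:arxiv-1610.02704` (§1.3, p. 5 and §7 "Proof of Theorem 1.11",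
p. 21, read first-hand 2026-08-28; locators "p. N" = pages of that rendering, as in
`LPRelaxationsMaxCSP.lean`).

Printed statements (verbatim up to notation) and how they are rendered:

* §1.3 (p. 5): "For a non-negative matrix `M`, and `ε > 0`, define the `ε`-approximate non-negative rank
  as `nnr^ε(M) = min{nnr(M') : ‖M' − M‖_∞ ≤ ε ‖M‖_∞}`. Clearly, `nnr^ε(M) ≤ nnr(M)` for all `ε > 0`."
  — `HasApproxNonnegFactorization ε M r` ("`nnr^ε(M) ≤ r`"; `‖·‖_∞` = largest absolute entry, rendered as
  `⨆` over the (finite) index pairs), with `HasNonnegFactorization.hasApproxNonnegFactorization`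
  (the printed "clearly").
* **Theorem 1.11** (p. 5): "For all `ε > 0`, there exist constants `0 < c_ε, C_ε` such that the following
  holds. There exists an explicit non-negative matrix `M ∈ ℝ_{≥0}^{N×N}` such that
  `rank(M), nnr^ε(M) ≤ (log N)^{C_ε}`, and `nnr(M) > N^{c_ε}`."  — `KothariMekaRaghavendra2017_thm111`.
  RENDERING (recorded, not silent): (i) the printed sentence leaves `N` unquantified; it is typed in the
  only contentful reading, "for every `N₀` there is such an `M` with `N ≥ N₀`" (an infinite family — the
  proof, p. 21, takes `M = M_f^b`, `N = 2^{bn}`, for every large `n`); (ii) "explicit": the matrix is the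
  pattern matrix `M_f^b` (Def. 1.7) of `f = 1 − 2a − ℑ` for a Max-3-Sat instance `ℑ` with `opt(ℑ) ≤ 15/16`
  whose linear-degree Sherali–Adams value is `1` — in print "such instances exist by [Gri01, Schoenebeck08]"
  (p. 21); in the tree they come from `Schoenebeck2008_maxThreeSatSos_holds` (probabilistic existence,
  `ThreeSatThreeXorSosGaps.lean`), so the Lean statement asserts existence, exactly as typed for LRS
  Thm 6.5 / KMR Thm 7.5; (iii) logarithms are base `2` (footnote p. 7: "all logarithms are base 2");
  (iv) "`nnr(M) > N^{c}`" = no non-negative factorization of any size `r ≤ N^{c}`;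
  "`rank(M), nnr^ε(M) ≤ (log N)^{C}`" = `Matrix.rank ≤ (log₂ N)^C` and an `ε`-approximate non-negative
  factorization of some size `r ≤ (log₂ N)^C`.

PROOF (the printed sketch, p. 21, made precise; the arXiv source comments "We only sketch the argument
here" and, at Thm 1.11, "Need to write down the proof somewhere").  Fix `ε > 0`; put `ε₁ = min(ε,1)`,
`a = ε₁/128`.  By KMR Thm 7.5 for Max-3-Sat at `1/16` (`KothariMekaRaghavendra2017_thm75_threeSat`,
unconditional in the tree) there are `c₃ > 0`, `n₃` such that for `n ≥ n₃` and `2d ≤ ⌊c₃ n⌋` degree-`d`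
Sherali–Adams fails `(1 − a, 15/16)`; Fact 3.4 (`exists_nonnegDegree_gt_of_not_saAchieves`) turns this
into an instance `ℑ` with `opt(ℑ) ≤ 15/16` and `deg_+((1 − a) − ℑ) > d`.  Put `f = 1 − 2a − ℑ`
(`3/64 ≤ f ≤ 1`, `deg f ≤ 3`), `b = ⌈C log₂ n⌉ + 1`, `N = 2^{bn}`, `M = M_f^b` (re-indexed by `Fin N`).
Then: `rank(M) ≤ binom(n,3)·2^{3b}` (`rank_ipPatternMatrix_le_of_hasDegreeLE`, the p. 21 bound);
`h = (1 − 2a)(1 − ℑ)` is a conical `3`-junta with `0 ≤ h − f = 2a·ℑ ≤ 2a ≤ ε · 3/64 ≤ ε ‖M‖_∞`, so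
`nnr^ε(M) ≤ nnr(M_h^b) ≤ binom(n,3)·2^{3b}` (eq. (1.2), `hasNonnegFactorization_ipPatternMatrix_of_isConicalJunta`)
— here the printed "`deg_+^ε(f) = O(log(1/ε))` … similar argument used in [CLRS13]" is replaced by the
exact observation `deg_+^ε(f) ≤ 3` for this shift `2a ≍ ε`, which is all the statement needs; and
`binom(n,3) 2^{3b} ≤ 64 n^{3C+3} ≤ (bn)^{3C+10} = (log₂ N)^{3C+10}`.  Finally Theorem 1.10
(`KothariMekaRaghavendra2017_thm110_holds`) applied to `F = f/E[f]`, `η = 1/n`: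
`deg_+(F + 1/n) = deg_+(f + E[f]/n) ≥ deg_+((1 − a) − ℑ) > d ≥ c₃ n/2 − 1` (a larger non-negative shift
only lowers `deg_+`, `nonnegDegree_add_const_le`; `E[f]/n ≤ a` for `n ≥ 128/ε₁`), so
`nnr(M) = nnr(M_F^b) ≥ 2^{c₀ b (c₃ n/2 − 24)} > 2^{c₀ c₃ b n/16} = N^{c₀ c₃/16}` once `c₃ n ≥ 55`.
Constants: `c = c₀ c₃/16`, `C' = 3C + 10` (independent of `ε`, which the printed `c_ε, C_ε` allow).

One new notion with a body (`HasApproxNonnegFactorization`, KMR's `nnr^ε`); no named facts; no instances,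
no notation; standard axioms.  Label: literature formalization (row (5) of the literature-typing layer,
cell pnp-psdrank); no P-vs-NP content.
-/

noncomputable section

open Finset Matrix

namespace Literature.Combinatorics.Optimization

/-! ### `ε`-approximate non-negative rank (§1.3) -/

/-- **`nnr^ε(M) ≤ r`** (KMR §1.3): some matrix `M'` with `‖M' − M‖_∞ ≤ ε ‖M‖_∞` (entrywise sup norms)
has a non-negative factorization of size `r`; "`nnr^ε(M) = min{nnr(M') : ‖M' − M‖_∞ ≤ ε‖M‖_∞}`".
[cite: KothariMekaRaghavendra2017, §1.3 (p. 5)] -/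
def HasApproxNonnegFactorization {ι κ : Type*} [Fintype ι] [Fintype κ] (ε : ℝ) (M : ι → κ → ℝ)
    (r : ℕ) : Prop :=
  ∃ M' : ι → κ → ℝ, (∀ i j, |M' i j - M i j| ≤ ε * ⨆ p : ι × κ, |M p.1 p.2|) ∧
    HasNonnegFactorization M' r

/-- "Clearly, `nnr^ε(M) ≤ nnr(M)` for all `ε > 0`" (take `M' = M`; `ε ≥ 0` suffices).
[cite: KothariMekaRaghavendra2017, §1.3 (p. 5)] -/
theorem HasNonnegFactorization.hasApproxNonnegFactorization {ι κ : Type*} [Fintype ι] [Fintype κ]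
    {M : ι → κ → ℝ} {r : ℕ} (h : HasNonnegFactorization M r) {ε : ℝ} (hε : 0 ≤ ε) :
    HasApproxNonnegFactorization ε M r := by
  refine ⟨M, fun i j => ?_, h⟩
  rw [sub_self, abs_zero]
  refine mul_nonneg hε (Real.iSup_nonneg fun p => abs_nonneg _)

/-! ### Two lemmas on Max-CSP objectives and non-negative degree -/

/-- The fraction of FALSIFIED constraints `1 − ℑ = (1/M) Σ_i (1 − P_i)` is a conical `k`-junta (each
`1 − P_i` is a non-negative `k`-junta). [cite: KothariMekaRaghavendra2017, §3.3 (p. 9) and §7 (p. 21: "f(x) = 1 − 2ε − ℑ(x)")] -/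
theorem CSPInstance.isConicalJunta_one_sub_val {k n : ℕ} {P : Set ((Fin k → Bool) → Bool)}
    (I : CSPInstance k n P) : IsConicalJunta k (fun x => 1 - I.val x) := by
  classical
  have hM : (0 : ℝ) < I.M := by exact_mod_cast I.M_pos
  refine isConicalJunta_of_fintype (ι := Fin I.M) (fun _ => 1 / (I.M : ℝ))
    (fun i x => if (I.cons i).sat x then 0 else 1) (fun _ => by positivity) (fun i => ?_)
    (fun i x => by split_ifs <;> norm_num) (fun x => ?_)
  · refine ⟨univ.map (I.cons i).idx, by simp, fun x y hxy => ?_⟩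
    have hsat : (I.cons i).sat x = (I.cons i).sat y := by
      unfold CSPConstraint.sat
      congr 1
      funext j
      exact hxy _ (mem_map_of_mem _ (mem_univ j))
    simp only [hsat]
  · have hval : I.val x = (∑ i, if (I.cons i).sat x then (1 : ℝ) else 0) / I.M := rfl
    have hM0 : (I.M : ℝ) ≠ 0 := hM.ne'
    have hflip : (∑ i : Fin I.M, (if (I.cons i).sat x then (0 : ℝ) else 1)) =
        I.M - ∑ i, (if (I.cons i).sat x then (1 : ℝ) else 0) := by
      rw [eq_sub_iff_add_eq, ← Finset.sum_add_distrib]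
      have h1 : ∀ i ∈ (univ : Finset (Fin I.M)),
          ((if (I.cons i).sat x then (0 : ℝ) else 1) + (if (I.cons i).sat x then (1 : ℝ) else 0)) = 1 :=
        fun i _ => by split_ifs <;> norm_num
      rw [Finset.sum_congr rfl h1]
      simp
    rw [hval, ← Finset.mul_sum, hflip]
    field_simp

/-- A larger non-negative shift only lowers the non-negative degree: `deg_+(g + κ) ≤ deg_+(g)` for
`g ≥ 0`, `κ ≥ 0` (footnote p. 5: "`deg_+(f + η) ≤ deg_+(f)` for all `η > 0`").
[cite: KothariMekaRaghavendra2017, §1.2 footnote to Thm 1.10 (p. 5)] -/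
theorem nonnegDegree_add_const_le {n : ℕ} {g : (Fin n → Bool) → ℝ} (hg : ∀ z, 0 ≤ g z) {κ : ℝ}
    (hκ : 0 ≤ κ) : nonnegDegree (fun z => g z + κ) ≤ nonnegDegree g :=
  (isConicalJunta_iff_nonnegDegree_le fun z => add_nonneg (hg z) hκ).1
    ((isConicalJunta_nonnegDegree hg).add_const hκ)

/-- `|({0,1}^b)ⁿ| = 2^{bn}` (the side length `N` of `M_f^b`). [cite: KothariMekaRaghavendra2017, §7 (p. 21: "N = 2^{bn}")] -/
theorem card_blockIndex (n b : ℕ) : Fintype.card (Fin n → Fin b → Bool) = 2 ^ (b * n) := by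
  simp [pow_mul]

/-! ### Theorem 1.11 -/

/-- **Kothari–Meka–Raghavendra 2017, Theorem 1.11 — PROVED.**  For every `ε > 0` there are constants
`c, C > 0` such that for every `N₀` there are `N ≥ N₀` and a non-negative `N × N` matrix `M` with
`rank(M) ≤ (log₂ N)^C`, `nnr^ε(M) ≤ (log₂ N)^C` and `nnr(M) > N^{c}` (no non-negative factorization of
size `≤ N^c`).  The matrix is `M_f^b`, `f = 1 − 2a − ℑ_n` for a Schoenebeck Max-3-Sat instance `ℑ_n`,
`a ≍ ε`, `b ≍ log n` (see the module docstring for the readings of "explicit" and of the quantification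
over `N`). [cite: KothariMekaRaghavendra2017, Thm 1.11 (p. 5) with its proof sketch (§7, p. 21)] -/
theorem KothariMekaRaghavendra2017_thm111 :
    ∀ ε : ℝ, 0 < ε → ∃ c C : ℝ, 0 < c ∧ 0 < C ∧ ∀ N₀ : ℕ, ∃ N : ℕ, N₀ ≤ N ∧
      ∃ M : Fin N → Fin N → ℝ, (∀ i j, 0 ≤ M i j) ∧
        ((Matrix.of M).rank : ℝ) ≤ Real.logb 2 N ^ C ∧
        (∃ r : ℕ, (r : ℝ) ≤ Real.logb 2 N ^ C ∧ HasApproxNonnegFactorization ε M r) ∧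
        ∀ r : ℕ, (r : ℝ) ≤ (N : ℝ) ^ c → ¬ HasNonnegFactorization M r := by
  intro ε hε
  classical
  -- constants: Theorem 1.10 and Theorem 7.5 (Max-3-Sat at `1/16`)
  obtain ⟨c₀, C, hc₀, hC, h110⟩ := KothariMekaRaghavendra2017_thm110_holds
  obtain ⟨c₃, hc₃, n₃, hSch⟩ := KothariMekaRaghavendra2017_thm75_threeSat (ε := 1 / 16) (by norm_num)
  refine ⟨c₀ * c₃ / 16, 3 * C + 10, by positivity, by positivity, fun N₀ => ?_⟩
  -- the shift `a ≍ ε`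
  set ε₁ : ℝ := min ε 1 with hε₁
  have hε₁pos : 0 < ε₁ := lt_min hε one_pos
  have hε₁le : ε₁ ≤ ε := min_le_left _ _
  have hε₁le1 : ε₁ ≤ 1 := min_le_right _ _
  set a : ℝ := ε₁ / 128 with ha
  have ha_pos : 0 < a := by positivity
  have ha_le : a ≤ 1 / 128 := by rw [ha]; linarith
  -- the number of variables `n`
  set n : ℕ := max (max N₀ n₃) (max (⌈128 / ε₁⌉₊ + 3) (⌈55 / c₃⌉₊ + 1)) with hn_def
  have hnN₀ : N₀ ≤ n := le_trans (le_max_left _ _) (le_max_left _ _)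
  have hn₃ : n₃ ≤ n := le_trans (le_max_right _ _) (le_max_left _ _)
  have hn3 : 3 ≤ n := le_trans (by omega) (le_trans (le_max_left _ _) (le_max_right _ _))
  have hn_pos : (0 : ℝ) < n := by exact_mod_cast (show 0 < n by omega)
  have hn1 : (1 : ℝ) ≤ n := by exact_mod_cast (show 1 ≤ n by omega)
  have hn2 : (2 : ℝ) ≤ n := by exact_mod_cast (show 2 ≤ n by omega)
  have hn128 : 128 / ε₁ ≤ n := by
    calc 128 / ε₁ ≤ ⌈128 / ε₁⌉₊ := Nat.le_ceil _
      _ ≤ ((⌈128 / ε₁⌉₊ + 3 : ℕ) : ℝ) := by push_cast; linarith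
      _ ≤ n := by exact_mod_cast le_trans (le_max_left _ _) (le_max_right _ _)
  have hn55 : 55 ≤ c₃ * n := by
    have h1 : 55 / c₃ ≤ n := by
      calc 55 / c₃ ≤ ⌈55 / c₃⌉₊ := Nat.le_ceil _
        _ ≤ ((⌈55 / c₃⌉₊ + 1 : ℕ) : ℝ) := by push_cast; linarith
        _ ≤ n := by exact_mod_cast le_trans (le_max_right _ _) (le_max_right _ _)
    have := mul_le_mul_of_nonneg_left h1 hc₃.le
    rwa [mul_div_cancel₀ _ hc₃.ne'] at this
  have hinv_le_a : (1 : ℝ) / n ≤ a := by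
    rw [ha, div_le_div_iff₀ hn_pos (by norm_num : (0:ℝ) < 128), one_mul]
    have := mul_le_mul_of_nonneg_left hn128 hε₁pos.le
    rw [mul_div_cancel₀ _ hε₁pos.ne'] at this
    linarith [mul_comm (n : ℝ) ε₁]
  -- the block length `b`
  set b : ℕ := ⌈C * Real.logb 2 n⌉₊ + 1 with hb_def
  have hlog_nonneg : 0 ≤ Real.logb 2 n := Real.logb_nonneg one_lt_two hn1
  have hClog_nonneg : 0 ≤ C * Real.logb 2 n := mul_nonneg hC.le hlog_nonneg
  have hb1 : 1 ≤ b := by omega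
  have hb1r : (1 : ℝ) ≤ b := by exact_mod_cast hb1
  have hbC : C * Real.logb 2 n ≤ b := by
    rw [hb_def]; push_cast; linarith [Nat.le_ceil (C * Real.logb 2 n)]
  have hb_le : (b : ℝ) ≤ C * Real.logb 2 n + 2 := by
    rw [hb_def]; push_cast; linarith [Nat.ceil_lt_add_one hClog_nonneg]
  have hnC : (2 : ℝ) ^ (Real.logb 2 n * C) = (n : ℝ) ^ C := by
    rw [Real.rpow_mul zero_le_two, Real.rpow_logb two_pos (by norm_num) hn_pos]
  have h2b : ((2 : ℝ) ^ b : ℝ) ≤ 4 * (n : ℝ) ^ C := by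
    calc ((2 : ℝ) ^ b : ℝ) = (2 : ℝ) ^ (b : ℝ) := (Real.rpow_natCast 2 b).symm
      _ ≤ (2 : ℝ) ^ (C * Real.logb 2 n + 2) := Real.rpow_le_rpow_of_exponent_le one_le_two hb_le
      _ = (2 : ℝ) ^ (Real.logb 2 n * C) * (2 : ℝ) ^ (2 : ℝ) := by
        rw [← Real.rpow_add two_pos, mul_comm C]
      _ = 4 * (n : ℝ) ^ C := by rw [hnC]; norm_num; ring
  -- the degree `d` and the instance
  set d : ℕ := ⌊c₃ * n⌋₊ / 2 with hd_def
  have h2d : 2 * d ≤ ⌊c₃ * n⌋₊ := Nat.mul_div_le _ _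
  have hd_ge : c₃ * n / 2 - 1 ≤ d := by
    have h1 : (⌊c₃ * n⌋₊ : ℝ) ≤ 2 * d + 1 := by
      have : ⌊c₃ * n⌋₊ ≤ 2 * d + 1 := by omega
      exact_mod_cast this
    have h2 : c₃ * n - 1 ≤ ⌊c₃ * n⌋₊ := by
      have := Nat.lt_floor_add_one (c₃ * n)
      linarith
    linarith
  have hSA : ¬ SAAchieves (n := n) maxThreeSatPreds d (1 - a) (7 / 8 + 1 / 16) :=
    hSch n hn₃ d h2d (1 - a) (by linarith)
  obtain ⟨I, hIs, hdeg⟩ :=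
    exists_nonnegDegree_gt_of_not_saAchieves (by norm_num; linarith) hSA
  -- the function `f = 1 − 2a − ℑ`
  obtain ⟨f, hf⟩ : ∃ f : (Fin n → Bool) → ℝ, f = fun z => 1 - 2 * a - I.val z := ⟨_, rfl⟩
  have hf_lb : ∀ z, 3 / 64 ≤ f z := fun z => by
    rw [hf]; have := hIs z; dsimp only; linarith
  have hf_nonneg : ∀ z, 0 ≤ f z := fun z => le_trans (by norm_num) (hf_lb z)
  have hf_le : ∀ z, f z ≤ 1 := fun z => by
    rw [hf]; have := I.val_nonneg z; dsimp only; linarith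
  have hfdeg : HasDegreeLE 3 f := by
    rw [hf]; exact (HasDegreeLE.const 3 (1 - 2 * a)).sub I.hasDegreeLE_val
  -- the matrix, re-indexed by `Fin N`, `N = 2^{bn}`
  set N : ℕ := 2 ^ (b * n) with hN_def
  let e : (Fin n → Fin b → Bool) ≃ Fin N := Fintype.equivFinOfCardEq (card_blockIndex n b)
  let M : Fin N → Fin N → ℝ := fun i j => ipPatternMatrix b f (e.symm i) (e.symm j)
  have hM_entry : ∀ i j, 3 / 64 ≤ M i j := fun i j => hf_lb _
  have hN_real : (N : ℝ) = (2 : ℝ) ^ ((b : ℝ) * n) := by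
    rw [hN_def]; push_cast; rw [← Real.rpow_natCast]; push_cast; ring_nf
  have hlogN : Real.logb 2 N = b * n := by
    rw [hN_real, Real.logb_rpow two_pos (by norm_num)]
  -- the common size bound `binom(n,3) 2^{3b} ≤ (log₂ N)^{3C+10}`
  set r₀ : ℕ := n.choose 3 * 2 ^ (b * 3) with hr₀
  have hr₀_le : (r₀ : ℝ) ≤ Real.logb 2 N ^ (3 * C + 10) := by
    rw [hlogN]
    have hchoose : (n.choose 3 : ℝ) ≤ (n : ℝ) ^ (3 : ℕ) := by exact_mod_cast Nat.choose_le_pow n 3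
    have h2b3 : ((2 : ℝ) ^ (b * 3) : ℝ) ≤ 64 * (n : ℝ) ^ (3 * C) := by
      rw [pow_mul]
      calc ((2 : ℝ) ^ b) ^ 3 ≤ (4 * (n : ℝ) ^ C) ^ 3 := by gcongr
        _ = 64 * ((n : ℝ) ^ C) ^ (3 : ℕ) := by ring
        _ = 64 * (n : ℝ) ^ (3 * C) := by
          congr 1
          rw [← Real.rpow_natCast ((n : ℝ) ^ C) 3, ← Real.rpow_mul hn_pos.le,
            show C * ((3 : ℕ) : ℝ) = 3 * C by push_cast; ring]
    have hnpow : 64 * (n : ℝ) ^ (3 : ℕ) ≤ (n : ℝ) ^ (10 : ℕ) := by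
      have h7 : (64 : ℝ) ≤ (n : ℝ) ^ (7 : ℕ) := by
        calc (64 : ℝ) ≤ 2 ^ (7 : ℕ) := by norm_num
          _ ≤ (n : ℝ) ^ (7 : ℕ) := by gcongr
      calc 64 * (n : ℝ) ^ (3 : ℕ) = (n : ℝ) ^ (3 : ℕ) * 64 := by ring
        _ ≤ (n : ℝ) ^ (3 : ℕ) * (n : ℝ) ^ (7 : ℕ) := by gcongr
        _ = (n : ℝ) ^ (10 : ℕ) := by ring
    calc (r₀ : ℝ) = (n.choose 3 : ℝ) * (2 : ℝ) ^ (b * 3) := by rw [hr₀]; push_cast; ring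
      _ ≤ (n : ℝ) ^ (3 : ℕ) * (64 * (n : ℝ) ^ (3 * C)) := by gcongr
      _ = (64 * (n : ℝ) ^ (3 : ℕ)) * (n : ℝ) ^ (3 * C) := by ring
      _ ≤ (n : ℝ) ^ (10 : ℕ) * (n : ℝ) ^ (3 * C) := by gcongr
      _ = (n : ℝ) ^ (3 * C + 10) := by
        rw [← Real.rpow_natCast (n : ℝ) 10, ← Real.rpow_add hn_pos]; push_cast; ring_nf
      _ ≤ ((b : ℝ) * n) ^ (3 * C + 10) := by
        refine Real.rpow_le_rpow hn_pos.le ?_ (by positivity)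
        exact le_mul_of_one_le_left hn_pos.le hb1r
  refine ⟨N, ?_, M, fun i j => hf_nonneg _, ?_, ⟨r₀, hr₀_le, ?_⟩, ?_⟩
  · -- `N ≥ N₀`
    calc N₀ ≤ n := hnN₀
      _ ≤ 2 ^ n := (Nat.lt_two_pow_self).le
      _ ≤ 2 ^ (b * n) := Nat.pow_le_pow_right two_pos (Nat.le_mul_of_pos_left n hb1)
  · -- `rank(M) ≤ binom(n,3) 2^{3b} ≤ (log₂ N)^{3C+10}`
    have hre : Matrix.of M = Matrix.reindex e e (Matrix.of (ipPatternMatrix b f)) := by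
      ext i j; simp [M]
    have hrk : (Matrix.of M).rank ≤ r₀ := by
      rw [hre, Matrix.rank_reindex]
      exact rank_ipPatternMatrix_le_of_hasDegreeLE b hn3 hfdeg
    exact le_trans (by exact_mod_cast hrk) hr₀_le
  · -- `nnr^ε(M) ≤ binom(n,3) 2^{3b}` via `h = (1 − 2a)(1 − ℑ)`
    obtain ⟨h, hh⟩ : ∃ h : (Fin n → Bool) → ℝ, h = fun z => (1 - 2 * a) * (1 - I.val z) := ⟨_, rfl⟩
    have hh_conical : IsConicalJunta 3 h := by
      rw [hh]; exact I.isConicalJunta_one_sub_val.smul (by linarith)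
    have hh_fac : HasNonnegFactorization (ipPatternMatrix b h) r₀ :=
      hasNonnegFactorization_ipPatternMatrix_of_isConicalJunta b hn3 hh_conical
    refine ⟨fun i j => ipPatternMatrix b h (e.symm i) (e.symm j), fun i j => ?_,
      hh_fac.submatrix _ _⟩
    have hdiff : ipPatternMatrix b h (e.symm i) (e.symm j) - M i j =
        2 * a * I.val (fun l => ipGadget b (e.symm i l) (e.symm j l)) := by
      simp only [M, ipPatternMatrix, hh, hf]; ring
    have hval0 := I.val_nonneg (fun l => ipGadget b (e.symm i l) (e.symm j l))
    have hval1 := I.val_le_one (fun l => ipGadget b (e.symm i l) (e.symm j l))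
    have hsup : M i j ≤ ⨆ p : Fin N × Fin N, |M p.1 p.2| :=
      le_trans (le_abs_self _)
        (le_ciSup (f := fun p : Fin N × Fin N => |M p.1 p.2|) (Set.finite_range _).bddAbove (i, j))
    rw [hdiff, abs_of_nonneg (mul_nonneg (by positivity) hval0)]
    calc 2 * a * I.val _ ≤ 2 * a := mul_le_of_le_one_right (by positivity) hval1
      _ ≤ ε * (3 / 64) := by rw [ha]; linarith
      _ ≤ ε * ⨆ p : Fin N × Fin N, |M p.1 p.2| :=
        mul_le_mul_of_nonneg_left ((hM_entry i j).trans hsup) hε.le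
  · -- `nnr(M) > N^{c₀ c₃/16}` by Theorem 1.10
    intro r hr hfacM
    -- back to the pattern matrix of `f`, then normalise to mean one
    have hfac : HasNonnegFactorization (ipPatternMatrix b f) r := by
      have h' := hfacM.submatrix e e
      have hMeq : (fun x y => M (e x) (e y)) = ipPatternMatrix b f := by
        funext x y; simp [M]
      rw [hMeq] at h'
      exact h'
    obtain ⟨μ, hμ⟩ : ∃ μ : ℝ, μ = cubeExpect f := ⟨_, rfl⟩
    have hμ_ge : 3 / 64 ≤ μ := by
      rw [hμ, ← cubeExpect_const n (3 / 64)]; exact cubeExpect_mono hf_lb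
    have hμ_le : μ ≤ 1 := by rw [hμ]; exact cubeExpect_le_of_forall_le hf_le
    have hμ_pos : 0 < μ := lt_of_lt_of_le (by norm_num) hμ_ge
    obtain ⟨f₀, hf₀⟩ : ∃ f₀ : (Fin n → Bool) → ℝ, f₀ = fun z => μ⁻¹ * f z := ⟨_, rfl⟩
    have hf₀_nonneg : ∀ z, 0 ≤ f₀ z := fun z => by
      rw [hf₀]; exact mul_nonneg (inv_nonneg.2 hμ_pos.le) (hf_nonneg z)
    have hf₀_exp : cubeExpect f₀ = 1 := by
      rw [hf₀, cubeExpect_const_mul, ← hμ, inv_mul_cancel₀ hμ_pos.ne']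
    have hfac₀ : HasNonnegFactorization (ipPatternMatrix b f₀) r := by
      rw [hf₀, ipPatternMatrix_const_mul]
      exact hfac.const_mul (inv_nonneg.2 hμ_pos.le)
    have hdegf₀ : (cubeDegree f₀ : ℝ) ≤ 3 := by
      have : HasDegreeLE 3 f₀ := by rw [hf₀]; exact hfdeg.const_mul μ⁻¹
      exact_mod_cast cubeDegree_le_of_hasDegreeLE this
    -- `deg_+(f₀ + 1/n) = deg_+(f + μ/n) ≥ deg_+((1 − a) − ℑ) > d`
    have hμ0 : μ ≠ 0 := hμ_pos.ne'
    have hsum : (fun z => f₀ z + 1 / n) = fun z => μ⁻¹ * (f z + μ / n) := by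
      funext z
      rw [hf₀]
      show μ⁻¹ * f z + 1 / n = μ⁻¹ * (f z + μ / n)
      rw [mul_add, ← mul_div_assoc, inv_mul_cancel₀ hμ0]
    have hshift : (fun z => (1 - a) - I.val z) = fun z => (f z + μ / n) + (a - μ / n) := by
      funext z; simp only [hf]; ring
    have hκ : 0 ≤ a - μ / n := by
      have : μ / n ≤ 1 / n := div_le_div_of_nonneg_right hμ_le hn_pos.le
      linarith
    have hdegp : (d : ℝ) + 1 ≤ (nonnegDegree fun z => f₀ z + 1 / n : ℝ) := by
      rw [hsum, nonnegDegree_const_mul (inv_pos.2 hμ_pos)]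
      have h1 : nonnegDegree (fun z => (1 - a) - I.val z) ≤ nonnegDegree fun z => f z + μ / n := by
        rw [hshift]
        exact nonnegDegree_add_const_le (g := fun z => f z + μ / n)
          (fun z => add_nonneg (hf_nonneg z) (div_nonneg hμ_pos.le hn_pos.le)) hκ
      have h2 : d + 1 ≤ nonnegDegree fun z => f z + μ / n := lt_of_lt_of_le hdeg h1
      exact_mod_cast h2
    -- Theorem 1.10
    refine h110 n (le_trans (by norm_num) hn3) f₀ hf₀_nonneg hf₀_exp (1 / n) le_rfl b hb1 hbC r ?_
      hfac₀
    -- `r ≤ N^{c₀ c₃ /16} < 2^{c₀ b (deg_+ − 8 deg)}`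
    have hcb : 0 < c₀ * b := by positivity
    have hE : c₀ * b * (c₃ * n / 2 - 24) ≤
        c₀ * b * ((nonnegDegree (fun z => f₀ z + 1 / n) : ℝ) - 8 * cubeDegree f₀) := by
      apply mul_le_mul_of_nonneg_left ?_ hcb.le
      linarith
    have hlt : (b : ℝ) * n * (c₀ * c₃ / 16) < c₀ * b * (c₃ * n / 2 - 24) := by
      have h7 : (0 : ℝ) < 7 * (c₃ * n) / 16 - 24 := by linarith
      have hexp : c₀ * b * (c₃ * n / 2 - 24) - (b : ℝ) * n * (c₀ * c₃ / 16) =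
          c₀ * b * (7 * (c₃ * n) / 16 - 24) := by ring
      have hpos : 0 < c₀ * b * (7 * (c₃ * n) / 16 - 24) := mul_pos hcb h7
      linarith
    calc (r : ℝ) ≤ (N : ℝ) ^ (c₀ * c₃ / 16) := hr
      _ = (2 : ℝ) ^ ((b : ℝ) * n * (c₀ * c₃ / 16)) := by rw [hN_real, ← Real.rpow_mul zero_le_two]
      _ < (2 : ℝ) ^ (c₀ * b * (c₃ * n / 2 - 24)) := Real.rpow_lt_rpow_of_exponent_lt one_lt_two hlt
      _ ≤ (2 : ℝ) ^ (c₀ * b * ((nonnegDegree (fun z => f₀ z + 1 / n) : ℝ) - 8 * cubeDegree f₀)) :=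
        Real.rpow_le_rpow_of_exponent_le one_le_two hE

end Literature.Combinatorics.Optimization

end
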